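import Summits.ABC.IUTFork.Cor312GenuineKTwistExactTriple
import Summits.ABC.IUTFork.Cor312GenuineKCyclotomicLowerBound
import Summits.ABC.IUTFork.Conditional.WRowUnconditionalPackages
import Summits.ABC.IUTFork.Conditional.AbcOfSGenuineKLinUniformRows5
import HarnessLib

/-!
# R-W «W:INH-BANDS-REFUTED-SIDE», packages of the OVERLAP triple `2⁵·67⁸·107·22381 + 5⁴·53⁶·353⁵ = 3²²·7¹⁴·43·83`: the bad primes, the pole orders
# of `j`, and the LOWER local-type classes `E₀(p)·l ∣ e(K_x/ℚ_p)` at every bad fibre point (incl. the TWIST class `30·l` at `43, 83 ∣ c`)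

PROOF-ONLY file (D-0012; 0 definitions, 0 `Prop` facts, no instance) of the abc-iut cell — D-0079 RESCUE sub-cell R-W «WINDOW Θ-SIDE INEQUALITY»,
seat abc-iut-W-neg-1 (gen 4), row «W:INH-BANDS-REFUTED-SIDE» (abc-iut-plan C-R99 (b): the INHABITED twin of this seat's refuted bands p497594 /
p498239 / p501634 for the first OVERLAP triple). Pattern of abc-iut-W-row-1's `WRowFrey283Packages` / `WRowUnconditionalPackages` (the inputs of
abc-iut-W-num-6's uniform inhabited bands `InhUniformBand*`), for the triple `a = 2⁵·67⁸·107·22381`, `b = 5⁴·53⁶·353⁵`, `c = 3²²·7¹⁴·43·83`. TAKES NO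
SIDE on [IUTchIII] Cor. 3.12 (S. Mochizuki, *Inter-universal Teichmüller theory III*, Cor. 3.12 p. 173–174) or on any author.

* §1 `WRow.prime_eq_of_dvd_frey31117999167337103924704` (a prime divisor of `abc` is one of `2, 3, 5, 7, 43, 53, 67, 83, 107, 353, 22381`),
  `WRow.factorization_frey31117999167337103924704` (`v_p(abc)` at the ten odd primes), `WRow.dvd_abc_of_ord_jInv_neg_triple` (general abc triple: a pole
  of `j(a/c)` lies over a prime of `abc`), **`WRow.bad_prime_frey31117999167337103924704`** (a bad fibre point `x ∣ p` of a genuine datum over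
  `(ratPoint (a/c), l)` forces `p ∤ 2l`, `p ∣ abc` and `ord_p j(a/c) = −2·v_p(abc)`).
* §2 **`WRow.dvd_absRamificationIdx_frey31117999167337103924704`** — at every fibre point `x ∣ p` (`p ≠ l`) the LOWER class BY NAME: `30·l` over `3`
  (`v = 22`, W1 wild: abc-iut-W-neg-2's `…three_of_coprime`), `60·l` over `5` (`v = 4`), `15·l` over `7, 67, 107, 22381` (`v` coprime to `15`),
  **`30·l` over `43, 83`** (`∥ c`, `v = 1` odd: the TWIST class, this seat's `GenuineK.two_mul_prime_dvd_absRamificationIdx_kOf_triple_of_odd`, p500830),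
  `5·l` over `53` (`v = 6`), `3·l` over `353` (`v = 5`).
HONEST FRAMING: bookkeeping over OUR typed objects; nothing here bears on the printed inequality of [IUTchIII] Cor. 3.12; typed ≠ proved; no abc claim.
[cite: SilvermanATAEC1994, V.5 Thm. 5.3 and Cor. 5.4] [cite: SilvermanAEC2009, Prop. III.1.7(b)] [cite: Mochizuki2012, IUTchI Def. 3.1 (b),(c) p. 61, Ex. 3.2 (iv) p. 71; IUTchIV Cor. 2.2 (ii) proof (P5) p. 46]
[claim: Mochizuki2012, status: disputed] for every IUT quotation.
-/

noncomputable section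

open NumberField IsDedekindDomain

namespace Summit.ABC.IUTFork.Conditional

open Thm311 Thm311.Real Cor312 Cor312Prov Literature.IUT.LogVolume Literature.IUT.LogVolume.Cor22 Literature.IUT.HodgeTheaters
  Literature.IUT.LogThetaLattice Literature.NumberTheory.NumberFields Literature.NumberTheory.DiophantineGeometry.GenEll
  Literature.NumberTheory.DiophantineGeometry

/-! ## §1. The bad primes and the pole orders -/

/-- `v_p(n) = k` from `n = p^k·m` with `p ∤ m`. [folklore] -/
private theorem factorization_eq_of_eq_pow_mul' {p k m n : ℕ} (hp : p.Prime) (hn : n = p ^ k * m) (hm : ¬ p ∣ m) :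
    n.factorization p = k := by
  subst hn
  have hm0 : m ≠ 0 := fun h => hm (h ▸ dvd_zero p)
  rw [Nat.factorization_mul (pow_ne_zero _ hp.ne_zero) hm0, Finsupp.add_apply, hp.factorization_pow, Finsupp.single_eq_same,
    Nat.factorization_eq_zero_of_not_dvd hm, add_zero]

/-- A prime `q` dividing `p^k` (`p` prime) equals `p`. [folklore] -/
private theorem eq_of_prime_dvd_prime_pow {q p k : ℕ} (hq : q.Prime) (hp : p.Prime) (h : q ∣ p ^ k) : q = p :=
  (Nat.prime_dvd_prime_iff_eq hq hp).mp (hq.dvd_of_dvd_pow h)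

/-- **The prime divisors of `abc`** for `a = 2⁵·67⁸·107·22381`, `b = 5⁴·53⁶·353⁵`, `c = 3²²·7¹⁴·43·83`. [folklore] -/
theorem WRow.prime_eq_of_dvd_frey31117999167337103924704 {p : ℕ} (hp : p.Prime)
    (h : p ∣ 2 ^ 5 * 67 ^ 8 * 107 * 22381 * (5 ^ 4 * 53 ^ 6 * 353 ^ 5) * (3 ^ 22 * 7 ^ 14 * 43 * 83)) :
    p = 2 ∨ p = 3 ∨ p = 5 ∨ p = 7 ∨ p = 43 ∨ p = 53 ∨ p = 67 ∨ p = 83 ∨ p = 107 ∨ p = 353 ∨ p = 22381 := by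
  have P2 : Nat.Prime 2 := by norm_num
  have P3 : Nat.Prime 3 := by norm_num
  have P5 : Nat.Prime 5 := by norm_num
  have P7 : Nat.Prime 7 := by norm_num
  have P43 : Nat.Prime 43 := by norm_num
  have P53 : Nat.Prime 53 := by norm_num
  have P67 : Nat.Prime 67 := by norm_num
  have P83 : Nat.Prime 83 := by norm_num
  have P107 : Nat.Prime 107 := by norm_num
  have P353 : Nat.Prime 353 := by norm_num
  have P22381 : Nat.Prime 22381 := by norm_num
  rcases (Nat.Prime.dvd_mul hp).mp h with h | h
  · rcases (Nat.Prime.dvd_mul hp).mp h with h | h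
    · -- `p ∣ a`
      rcases (Nat.Prime.dvd_mul hp).mp h with h | h
      · rcases (Nat.Prime.dvd_mul hp).mp h with h | h
        · rcases (Nat.Prime.dvd_mul hp).mp h with h | h
          · exact Or.inl (eq_of_prime_dvd_prime_pow hp P2 h)
          · exact Or.inr (Or.inr (Or.inr (Or.inr (Or.inr (Or.inr (Or.inl (eq_of_prime_dvd_prime_pow hp P67 h)))))))
        · exact Or.inr (Or.inr (Or.inr (Or.inr (Or.inr (Or.inr (Or.inr (Or.inr (Or.inl
            ((Nat.prime_dvd_prime_iff_eq hp P107).mp h)))))))))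
      · exact Or.inr (Or.inr (Or.inr (Or.inr (Or.inr (Or.inr (Or.inr (Or.inr (Or.inr (Or.inr
          ((Nat.prime_dvd_prime_iff_eq hp P22381).mp h))))))))))
    · -- `p ∣ b`
      rcases (Nat.Prime.dvd_mul hp).mp h with h | h
      · rcases (Nat.Prime.dvd_mul hp).mp h with h | h
        · exact Or.inr (Or.inr (Or.inl (eq_of_prime_dvd_prime_pow hp P5 h)))
        · exact Or.inr (Or.inr (Or.inr (Or.inr (Or.inr (Or.inl (eq_of_prime_dvd_prime_pow hp P53 h))))))
      · exact Or.inr (Or.inr (Or.inr (Or.inr (Or.inr (Or.inr (Or.inr (Or.inr (Or.inr (Or.inl (eq_of_prime_dvd_prime_pow hp P353 h))))))))))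
  · -- `p ∣ c`
    rcases (Nat.Prime.dvd_mul hp).mp h with h | h
    · rcases (Nat.Prime.dvd_mul hp).mp h with h | h
      · rcases (Nat.Prime.dvd_mul hp).mp h with h | h
        · exact Or.inr (Or.inl (eq_of_prime_dvd_prime_pow hp P3 h))
        · exact Or.inr (Or.inr (Or.inr (Or.inl (eq_of_prime_dvd_prime_pow hp P7 h))))
      · exact Or.inr (Or.inr (Or.inr (Or.inr (Or.inl ((Nat.prime_dvd_prime_iff_eq hp P43).mp h)))))
    · exact Or.inr (Or.inr (Or.inr (Or.inr (Or.inr (Or.inr (Or.inr (Or.inl ((Nat.prime_dvd_prime_iff_eq hp P83).mp h))))))))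

/-- **`v_p(abc)` at the ten odd primes of `abc`**: `22, 4, 14, 1, 6, 8, 1, 1, 5, 1` over `3, 5, 7, 43, 53, 67, 83, 107, 353, 22381`. [folklore] -/
theorem WRow.factorization_frey31117999167337103924704 {p : ℕ}
    (hp : p = 3 ∨ p = 5 ∨ p = 7 ∨ p = 43 ∨ p = 53 ∨ p = 67 ∨ p = 83 ∨ p = 107 ∨ p = 353 ∨ p = 22381) :
    (2 ^ 5 * 67 ^ 8 * 107 * 22381 * (5 ^ 4 * 53 ^ 6 * 353 ^ 5) * (3 ^ 22 * 7 ^ 14 * 43 * 83)).factorization p =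
      (if p = 3 then 22 else if p = 5 then 4 else if p = 7 then 14 else if p = 43 then 1 else if p = 53 then 6 else
        if p = 67 then 8 else if p = 83 then 1 else if p = 107 then 1 else if p = 353 then 5 else 1) := by
  rcases hp with rfl | rfl | rfl | rfl | rfl | rfl | rfl | rfl | rfl | rfl
  · exact factorization_eq_of_eq_pow_mul' (k := 22) (m := 2 ^ 5 * 67 ^ 8 * 107 * 22381 * (5 ^ 4 * 53 ^ 6 * 353 ^ 5) * (7 ^ 14 * 43 * 83))
      (by norm_num) (by ring) (by norm_num)
  · exact factorization_eq_of_eq_pow_mul' (k := 4) (m := 2 ^ 5 * 67 ^ 8 * 107 * 22381 * (53 ^ 6 * 353 ^ 5) * (3 ^ 22 * 7 ^ 14 * 43 * 83))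
      (by norm_num) (by ring) (by norm_num)
  · exact factorization_eq_of_eq_pow_mul' (k := 14) (m := 2 ^ 5 * 67 ^ 8 * 107 * 22381 * (5 ^ 4 * 53 ^ 6 * 353 ^ 5) * (3 ^ 22 * 43 * 83))
      (by norm_num) (by ring) (by norm_num)
  · exact factorization_eq_of_eq_pow_mul' (k := 1) (m := 2 ^ 5 * 67 ^ 8 * 107 * 22381 * (5 ^ 4 * 53 ^ 6 * 353 ^ 5) * (3 ^ 22 * 7 ^ 14 * 83))
      (by norm_num) (by ring) (by norm_num)
  · exact factorization_eq_of_eq_pow_mul' (k := 6) (m := 2 ^ 5 * 67 ^ 8 * 107 * 22381 * (5 ^ 4 * 353 ^ 5) * (3 ^ 22 * 7 ^ 14 * 43 * 83))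
      (by norm_num) (by ring) (by norm_num)
  · exact factorization_eq_of_eq_pow_mul' (k := 8) (m := 2 ^ 5 * 107 * 22381 * (5 ^ 4 * 53 ^ 6 * 353 ^ 5) * (3 ^ 22 * 7 ^ 14 * 43 * 83))
      (by norm_num) (by ring) (by norm_num)
  · exact factorization_eq_of_eq_pow_mul' (k := 1) (m := 2 ^ 5 * 67 ^ 8 * 107 * 22381 * (5 ^ 4 * 53 ^ 6 * 353 ^ 5) * (3 ^ 22 * 7 ^ 14 * 43))
      (by norm_num) (by ring) (by norm_num)
  · exact factorization_eq_of_eq_pow_mul' (k := 1) (m := 2 ^ 5 * 67 ^ 8 * 22381 * (5 ^ 4 * 53 ^ 6 * 353 ^ 5) * (3 ^ 22 * 7 ^ 14 * 43 * 83))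
      (by norm_num) (by ring) (by norm_num)
  · exact factorization_eq_of_eq_pow_mul' (k := 5) (m := 2 ^ 5 * 67 ^ 8 * 107 * 22381 * (5 ^ 4 * 53 ^ 6) * (3 ^ 22 * 7 ^ 14 * 43 * 83))
      (by norm_num) (by ring) (by norm_num)
  · exact factorization_eq_of_eq_pow_mul' (k := 1) (m := 2 ^ 5 * 67 ^ 8 * 107 * (5 ^ 4 * 53 ^ 6 * 353 ^ 5) * (3 ^ 22 * 7 ^ 14 * 43 * 83))
      (by norm_num) (by ring) (by norm_num)

/-- **A POLE of `j(a/c)` lies over a prime of `abc`** (any abc triple `a + b = c`): `j(a/c) = 2⁸(cb + a²)³/(abc)²` (the tree's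
`Cor22.jInv_ratPoint_triple`), so at a place `v` of `ℚ` over a prime `p ∤ abc` one has `ord_v j(a/c) ≥ 0`. [cite: MochizukiGenEll2010, Def. 3.3 p. 12] -/
theorem WRow.dvd_abc_of_ord_jInv_neg_triple {a b c : ℕ} (habc : IsABCTriple a b c) (v : HeightOneSpectrum (𝓞 ℚ))
    (hneg : ord ℚ v (Cor22.jInv ((a : ℚ) / c)) < 0) : Rat.HeightOneSpectrum.natGenerator v ∣ a * b * c := by
  by_contra hnd
  have ha : 0 < a := habc.1
  have hb : 0 < b := habc.2.1
  have hc : 0 < c := by have := habc.2.2.1; omega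
  have habc0 : a * b * c ≠ 0 := by positivity
  set p := Rat.HeightOneSpectrum.natGenerator v with hpdef
  have hN0' : 256 * (c * b + a * a) ^ 3 ≠ 0 := by positivity
  have hN0 : ((256 * (c * b + a * a) ^ 3 : ℕ) : ℚ) ≠ 0 := by exact_mod_cast hN0'
  have hD0 : (((a * b * c) ^ 2 : ℕ) : ℚ) ≠ 0 := by exact_mod_cast pow_ne_zero 2 habc0
  have hordN : (0 : ℤ) ≤ ord ℚ v ((256 * (c * b + a * a) ^ 3 : ℕ) : ℚ) := by
    rw [ord_natCast_eq_factorization v hN0']; exact_mod_cast Nat.zero_le _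
  have hordD : ord ℚ v (((a * b * c) ^ 2 : ℕ) : ℚ) = 0 := by
    rw [ord_natCast_eq_factorization v (pow_ne_zero 2 habc0), ← hpdef, Nat.factorization_pow]
    simp [Nat.factorization_eq_zero_of_not_dvd hnd]
  have h := Cor22.jInv_ratPoint_triple habc
  rw [h, div_eq_mul_inv, ord_mul ℚ v hN0 (inv_ne_zero hD0), ord_inv, hordD] at hneg
  linarith

/-- **The bad fibre points of a genuine datum over `(ratPoint (a/c), l)` for the first OVERLAP triple**: a fibre point `x ∣ p` in the bad locus `S` of
`pilotDataOfK T.D T.K` has `p ≠ 2`, `p ≠ l` ([IUTchI] Def. 3.1 (b),(c): `Cor312Prov.ne_two_and_ne_l_of_placeOf_mem_S_pilotDataOfK`), **`p ∣ abc`**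
(the chosen realising q-idele has norm `< 1` there, i.e. `j` has a pole below, `Cor312Prov.norm_chosenQIdele_lt_one` + `WRow.dvd_abc_of_ord_jInv_neg_triple`),
hence `p ∈ {3, 5, 7, 43, 53, 67, 83, 107, 353, 22381}`, and `ord_p j(a/c) = −2·v_p(abc)` at the place below `x` (`Cor22.ord_jInv_ratPoint_triple_eq`).
[cite: Mochizuki2012, IUTchI Def. 3.1 (b),(c) p. 61; IUTchIV Cor. 2.2 (ii) proof (P5) p. 46] [claim: Mochizuki2012, status: disputed] -/
theorem WRow.bad_prime_frey31117999167337103924704 {l : ℕ}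
    (T : Cor22.ThetaVolumeDatumAt (ratPoint (((2 ^ 5 * 67 ^ 8 * 107 * 22381 : ℕ) : ℚ) / (3 ^ 22 * 7 ^ 14 * 43 * 83 : ℕ))) l) (pp : Nat.Primes) :
    letI := T.instFieldF; letI := T.instNumberFieldF; letI := T.instAlgebraF; letI := T.instFieldK
    letI := T.instNumberFieldK; letI := T.instAlgebraK; letI := T.instFieldFbar; letI := T.instAlgebraFbar
    letI := T.instAlgebraKFbar; letI := T.instIsElliptic
    haveI : Fact (pp : ℕ).Prime := ⟨pp.2⟩
    ∀ x : (thetaIndex (pilotDataOfK T.D T.K)).Fibre (.inr pp), placeOf (pilotDataOfK T.D T.K) pp.1 x ∈ (pilotDataOfK T.D T.K).S →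
      (pp : ℕ) ≠ 2 ∧ (pp : ℕ) ≠ l ∧ (pp : ℕ) ∣ 2 ^ 5 * 67 ^ 8 * 107 * 22381 * (5 ^ 4 * 53 ^ 6 * 353 ^ 5) * (3 ^ 22 * 7 ^ 14 * 43 * 83) ∧
      ((pp : ℕ) = 3 ∨ (pp : ℕ) = 5 ∨ (pp : ℕ) = 7 ∨ (pp : ℕ) = 43 ∨ (pp : ℕ) = 53 ∨ (pp : ℕ) = 67 ∨ (pp : ℕ) = 83 ∨ (pp : ℕ) = 107 ∨
        (pp : ℕ) = 353 ∨ (pp : ℕ) = 22381) ∧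
      ord ℚ (finBelow ℚ T.K (placeOf (pilotDataOfK T.D T.K) pp.1 x))
          (jInv (((2 ^ 5 * 67 ^ 8 * 107 * 22381 : ℕ) : ℚ) / (3 ^ 22 * 7 ^ 14 * 43 * 83 : ℕ))) =
        -(2 * (((2 ^ 5 * 67 ^ 8 * 107 * 22381 * (5 ^ 4 * 53 ^ 6 * 353 ^ 5) * (3 ^ 22 * 7 ^ 14 * 43 * 83)).factorization pp : ℕ) : ℤ)) := by
  letI := T.instFieldF; letI := T.instNumberFieldF; letI := T.instAlgebraF; letI := T.instFieldK
  letI := T.instNumberFieldK; letI := T.instAlgebraK; letI := T.instFieldFbar; letI := T.instAlgebraFbar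
  letI := T.instAlgebraKFbar; letI := T.instIsElliptic
  haveI : Fact (pp : ℕ).Prime := ⟨pp.2⟩
  intro x hx
  have habc := isABCTriple_frey31117999167337103924704
  have hjF : T.E.j = ((jInv (((2 ^ 5 * 67 ^ 8 * 107 * 22381 : ℕ) : ℚ) / (3 ^ 22 * 7 ^ 14 * 43 * 83 : ℕ)) : ℚ) : T.F) := by
    rw [T.j_eq]; exact eq_ratCast _ _
  have hp1 : (1 : ℝ) < ((pp : ℕ) : ℝ) := by exact_mod_cast pp.2.one_lt
  have hgen := natGenerator_finBelow_placeOf T.D pp x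
  -- a pole of `j` under the bad place (adapted from abc-iut-W-row-1's `WRow.bad_prime_frey283`)
  have hneg : ord ℚ (finBelow ℚ T.K (placeOf (pilotDataOfK T.D T.K) pp.1 x))
      (jInv (((2 ^ 5 * 67 ^ 8 * 107 * 22381 : ℕ) : ℚ) / (3 ^ 22 * 7 ^ 14 * 43 * 83 : ℕ))) < 0 := by
    have hlt := norm_chosenQIdele_lt_one T.D pp x hx
    rw [norm_chosenQIdele_eq_rpow_ord_rat' T.D pp x hx _ hjF] at hlt
    by_contra hge
    push Not at hge
    have hl : (0 : ℝ) < 2 * (l : ℕ) := by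
      have : 0 < l := lt_of_lt_of_le (by norm_num) T.D.five_le_l
      positivity
    have hexp : (0 : ℝ) ≤ (ord ℚ (finBelow ℚ T.K (placeOf (pilotDataOfK T.D T.K) pp.1 x))
        (jInv (((2 ^ 5 * 67 ^ 8 * 107 * 22381 : ℕ) : ℚ) / (3 ^ 22 * 7 ^ 14 * 43 * 83 : ℕ))) : ℝ) / (2 * (l : ℕ)) :=
      div_nonneg (by exact_mod_cast hge) hl.le
    have h1 := (Real.rpow_le_rpow_left_iff hp1).mpr hexp
    rw [Real.rpow_zero] at h1
    linarith
  obtain ⟨h2, hl'⟩ := ne_two_and_ne_l_of_placeOf_mem_S_pilotDataOfK T.D pp x hx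
  have hdvd : (pp : ℕ) ∣ 2 ^ 5 * 67 ^ 8 * 107 * 22381 * (5 ^ 4 * 53 ^ 6 * 353 ^ 5) * (3 ^ 22 * 7 ^ 14 * 43 * 83) := by
    have h := WRow.dvd_abc_of_ord_jInv_neg_triple habc _ hneg
    rw [hgen] at h
    exact h
  have hmem := WRow.prime_eq_of_dvd_frey31117999167337103924704 pp.2 hdvd
  refine ⟨h2, hl', hdvd, ?_, ?_⟩
  · rcases hmem with h | h
    · exact absurd h h2
    · exact h
  · rw [Cor22.ord_jInv_ratPoint_triple_eq habc _ (by rw [hgen]; exact h2) (by rw [hgen]; exact hdvd), hgen]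

/-! ## §2. The LOWER local-type classes at the bad fibre -/

/-- **`E₀(p)·l ∣ e(K_x/ℚ_p)` at every fibre point `x ∣ p` (`p ≠ l`) of a genuine datum over the first OVERLAP triple**, BY NAME: `30·l` over `3`
(`v₃ = 22` coprime to `15`: abc-iut-W-neg-2's `GenuineK.thirty_mul_prime_dvd_absRamificationIdx_kOf_three_of_coprime`), `60·l` over `5` (`v₅ = 4`,
`…sixty…five_of_coprime`), `15·l` over `7, 67, 107, 22381` (`v = 14, 8, 1, 1` coprime to `15`: abc-iut-W-neg-1's `…fifteen…ratPoint_of_coprime`),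
**`30·l` over `43, 83`** (`43, 83 ∥ c`: the TWIST class, `GenuineK.two_mul_prime_dvd_absRamificationIdx_kOf_triple_of_odd` p500830 with `15·l ∣ e`),
`5·l` over `53` (`v = 6`: `15·l ∣ 6e`) and `3·l` over `353` (`v = 5`: `15·l ∣ 5e`), by `GenuineK.fifteen_mul_prime_dvd_absRamificationIdx_kOf_mul_ratPoint`.
[cite: SilvermanATAEC1994, V.5 Thm. 5.3 and Cor. 5.4] [cite: Mochizuki2012, IUTchI Ex. 3.2 (iv) p. 71] [claim: Mochizuki2012, status: disputed] -/
theorem WRow.dvd_absRamificationIdx_frey31117999167337103924704 {l : ℕ}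
    (T : Cor22.ThetaVolumeDatumAt (ratPoint (((2 ^ 5 * 67 ^ 8 * 107 * 22381 : ℕ) : ℚ) / (3 ^ 22 * 7 ^ 14 * 43 * 83 : ℕ))) l)
    (pp : Nat.Primes) (hpl : (pp : ℕ) ≠ l) :
    letI := T.instFieldF; letI := T.instNumberFieldF; letI := T.instAlgebraF; letI := T.instFieldK
    letI := T.instNumberFieldK; letI := T.instAlgebraK; letI := T.instFieldFbar; letI := T.instAlgebraFbar
    letI := T.instAlgebraKFbar; letI := T.instIsElliptic
    haveI : Fact (pp : ℕ).Prime := ⟨pp.2⟩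
    ∀ x : (thetaIndex (pilotDataOfK T.D T.K)).Fibre (.inr pp),
      ((pp : ℕ) = 3 → 30 * l ∣ absRamificationIdx (pp : ℕ) (kOf (pilotDataOfK T.D T.K) pp.1 x)) ∧
      ((pp : ℕ) = 5 → 60 * l ∣ absRamificationIdx (pp : ℕ) (kOf (pilotDataOfK T.D T.K) pp.1 x)) ∧
      ((pp : ℕ) = 7 → 15 * l ∣ absRamificationIdx (pp : ℕ) (kOf (pilotDataOfK T.D T.K) pp.1 x)) ∧
      ((pp : ℕ) = 43 → 30 * l ∣ absRamificationIdx (pp : ℕ) (kOf (pilotDataOfK T.D T.K) pp.1 x)) ∧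
      ((pp : ℕ) = 53 → 5 * l ∣ absRamificationIdx (pp : ℕ) (kOf (pilotDataOfK T.D T.K) pp.1 x)) ∧
      ((pp : ℕ) = 67 → 15 * l ∣ absRamificationIdx (pp : ℕ) (kOf (pilotDataOfK T.D T.K) pp.1 x)) ∧
      ((pp : ℕ) = 83 → 30 * l ∣ absRamificationIdx (pp : ℕ) (kOf (pilotDataOfK T.D T.K) pp.1 x)) ∧
      ((pp : ℕ) = 107 → 15 * l ∣ absRamificationIdx (pp : ℕ) (kOf (pilotDataOfK T.D T.K) pp.1 x)) ∧
      ((pp : ℕ) = 353 → 3 * l ∣ absRamificationIdx (pp : ℕ) (kOf (pilotDataOfK T.D T.K) pp.1 x)) ∧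
      ((pp : ℕ) = 22381 → 15 * l ∣ absRamificationIdx (pp : ℕ) (kOf (pilotDataOfK T.D T.K) pp.1 x)) := by
  letI := T.instFieldF; letI := T.instNumberFieldF; letI := T.instAlgebraF; letI := T.instFieldK
  letI := T.instNumberFieldK; letI := T.instAlgebraK; letI := T.instFieldFbar; letI := T.instAlgebraFbar
  letI := T.instAlgebraKFbar; letI := T.instIsElliptic
  haveI : Fact (pp : ℕ).Prime := ⟨pp.2⟩
  intro x
  have habc := isABCTriple_frey31117999167337103924704
  have hl5 : 5 ≤ l := T.D.five_le_l
  have hlP : l.Prime := T.D.l_prime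
  -- the pole order `ord_p j(a/c) = −2·v_p(abc)` at the ten odd primes
  have hpole : ∀ {p₀ : ℕ} (hp₀ : p₀ = 3 ∨ p₀ = 5 ∨ p₀ = 7 ∨ p₀ = 43 ∨ p₀ = 53 ∨ p₀ = 67 ∨ p₀ = 83 ∨ p₀ = 107 ∨ p₀ = 353 ∨ p₀ = 22381),
      ∀ v : HeightOneSpectrum (𝓞 ℚ), Rat.HeightOneSpectrum.natGenerator v = p₀ →
        ord ℚ v (jInv (((2 ^ 5 * 67 ^ 8 * 107 * 22381 : ℕ) : ℚ) / (3 ^ 22 * 7 ^ 14 * 43 * 83 : ℕ))) =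
          -(2 * ((if p₀ = 3 then 22 else if p₀ = 5 then 4 else if p₀ = 7 then 14 else if p₀ = 43 then 1 else if p₀ = 53 then 6 else
            if p₀ = 67 then 8 else if p₀ = 83 then 1 else if p₀ = 107 then 1 else if p₀ = 353 then 5 else 1 : ℕ) : ℤ)) := by
    intro p₀ hp₀ v hv
    have hp2 : Rat.HeightOneSpectrum.natGenerator v ≠ 2 := by
      rw [hv]; rcases hp₀ with rfl | rfl | rfl | rfl | rfl | rfl | rfl | rfl | rfl | rfl <;> norm_num
    have hdvd : Rat.HeightOneSpectrum.natGenerator v ∣ 2 ^ 5 * 67 ^ 8 * 107 * 22381 * (5 ^ 4 * 53 ^ 6 * 353 ^ 5) * (3 ^ 22 * 7 ^ 14 * 43 * 83) := by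
      rw [hv]; rcases hp₀ with rfl | rfl | rfl | rfl | rfl | rfl | rfl | rfl | rfl | rfl <;> norm_num
    rw [Cor22.ord_jInv_ratPoint_triple_eq habc v hp2 hdvd, hv, WRow.factorization_frey31117999167337103924704 hp₀]
  refine ⟨fun hp => ?_, fun hp => ?_, fun hp => ?_, fun hp => ?_, fun hp => ?_, fun hp => ?_, fun hp => ?_, fun hp => ?_, fun hp => ?_,
    fun hp => ?_⟩
  · have hpp : pp = ⟨3, Nat.prime_three⟩ := Subtype.ext hp
    subst hpp
    exact GenuineK.thirty_mul_prime_dvd_absRamificationIdx_kOf_three_of_coprime T (fun h => hpl h.symm) (t := 22) (by norm_num)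
      (by decide) (fun v hv => by rw [hpole (Or.inl rfl) v hv]; norm_num) x
  · have hpp : pp = ⟨5, Nat.prime_five⟩ := Subtype.ext hp
    subst hpp
    exact GenuineK.sixty_mul_prime_dvd_absRamificationIdx_kOf_five_of_coprime T (fun h => hpl h.symm) (t := 4) (by norm_num)
      (by decide) (fun v hv => by rw [hpole (Or.inr (Or.inl rfl)) v hv]; norm_num) x
  · exact GenuineK.fifteen_mul_prime_dvd_absRamificationIdx_kOf_ratPoint_of_coprime T pp (by rw [hp]; norm_num) hpl (t := 14)
      (by norm_num) (by decide) (fun v hv => by rw [hpole (Or.inr (Or.inr (Or.inl hp))) v hv, hp]; norm_num) x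
  · -- `43 ∥ c`: twist `2·l ∣ e` and `15·l ∣ e·1`
    have h2 := GenuineK.two_mul_prime_dvd_absRamificationIdx_kOf_triple_of_odd habc T pp (by rw [hp]; norm_num) hpl
      (by rw [hp]; norm_num) (by
        have : (3 ^ 22 * 7 ^ 14 * 43 * 83).factorization (pp : ℕ) = 1 := by
          rw [hp]; exact factorization_eq_of_eq_pow_mul' (k := 1) (m := 3 ^ 22 * 7 ^ 14 * 83) (by norm_num) (by ring) (by norm_num)
        rw [this]; exact odd_one) x
    have h15 := GenuineK.fifteen_mul_prime_dvd_absRamificationIdx_kOf_ratPoint_of_coprime T pp (by rw [hp]; norm_num) hpl (t := 1)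
      (by norm_num) (by decide) (fun v hv => by rw [hpole (Or.inr (Or.inr (Or.inr (Or.inl hp)))) v hv, hp]; norm_num) x
    have hcop : Nat.Coprime 2 (15 * l) := by
      have hl2 : l ≠ 2 := by omega
      exact Nat.Coprime.mul_right (by norm_num) ((Nat.coprime_primes Nat.prime_two hlP).mpr hl2.symm)
    have := Nat.Coprime.mul_dvd_of_dvd_of_dvd hcop (dvd_trans (dvd_mul_right 2 l) h2) h15
    rwa [show 2 * (15 * l) = 30 * l by ring] at this
  · -- `53⁶ ∥ b`: `15·l ∣ 6e` ⇒ `5·l ∣ e`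
    have h15 := GenuineK.fifteen_mul_prime_dvd_absRamificationIdx_kOf_mul_ratPoint T pp (by rw [hp]; norm_num) hpl (t := 6)
      (by norm_num) (fun v hv => by rw [hpole (Or.inr (Or.inr (Or.inr (Or.inr (Or.inl hp))))) v hv, hp]; norm_num) x
    have h5 : 5 * l ∣ absRamificationIdx (pp : ℕ) (kOf (pilotDataOfK T.D T.K) pp.1 x) * 2 := by
      have : 5 * l * 3 ∣ absRamificationIdx (pp : ℕ) (kOf (pilotDataOfK T.D T.K) pp.1 x) * 2 * 3 := by
        rw [show 5 * l * 3 = 15 * l by ring, show absRamificationIdx (pp : ℕ) (kOf (pilotDataOfK T.D T.K) pp.1 x) * 2 * 3 =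
          absRamificationIdx (pp : ℕ) (kOf (pilotDataOfK T.D T.K) pp.1 x) * 6 by ring]; exact h15
      exact Nat.dvd_of_mul_dvd_mul_right (by norm_num) this
    have hcop : Nat.Coprime (5 * l) 2 := by
      have hl2 : l ≠ 2 := by omega
      exact Nat.Coprime.mul_left (by norm_num) ((Nat.coprime_primes hlP Nat.prime_two).mpr hl2)
    exact hcop.dvd_of_dvd_mul_right h5
  · exact GenuineK.fifteen_mul_prime_dvd_absRamificationIdx_kOf_ratPoint_of_coprime T pp (by rw [hp]; norm_num) hpl (t := 8)
      (by norm_num) (by decide) (fun v hv => by rw [hpole (Or.inr (Or.inr (Or.inr (Or.inr (Or.inr (Or.inl hp)))))) v hv, hp]; norm_num) x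
  · -- `83 ∥ c`: twist
    have h2 := GenuineK.two_mul_prime_dvd_absRamificationIdx_kOf_triple_of_odd habc T pp (by rw [hp]; norm_num) hpl
      (by rw [hp]; norm_num) (by
        have : (3 ^ 22 * 7 ^ 14 * 43 * 83).factorization (pp : ℕ) = 1 := by
          rw [hp]; exact factorization_eq_of_eq_pow_mul' (k := 1) (m := 3 ^ 22 * 7 ^ 14 * 43) (by norm_num) (by ring) (by norm_num)
        rw [this]; exact odd_one) x
    have h15 := GenuineK.fifteen_mul_prime_dvd_absRamificationIdx_kOf_ratPoint_of_coprime T pp (by rw [hp]; norm_num) hpl (t := 1)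
      (by norm_num) (by decide)
      (fun v hv => by rw [hpole (Or.inr (Or.inr (Or.inr (Or.inr (Or.inr (Or.inr (Or.inl hp))))))) v hv, hp]; norm_num) x
    have hcop : Nat.Coprime 2 (15 * l) := by
      have hl2 : l ≠ 2 := by omega
      exact Nat.Coprime.mul_right (by norm_num) ((Nat.coprime_primes Nat.prime_two hlP).mpr hl2.symm)
    have := Nat.Coprime.mul_dvd_of_dvd_of_dvd hcop (dvd_trans (dvd_mul_right 2 l) h2) h15
    rwa [show 2 * (15 * l) = 30 * l by ring] at this
  · exact GenuineK.fifteen_mul_prime_dvd_absRamificationIdx_kOf_ratPoint_of_coprime T pp (by rw [hp]; norm_num) hpl (t := 1)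
      (by norm_num) (by decide)
      (fun v hv => by rw [hpole (Or.inr (Or.inr (Or.inr (Or.inr (Or.inr (Or.inr (Or.inr (Or.inl hp)))))))) v hv, hp]; norm_num) x
  · -- `353⁵ ∥ b`: `15·l ∣ 5e` ⇒ `3·l ∣ e`
    have h15 := GenuineK.fifteen_mul_prime_dvd_absRamificationIdx_kOf_mul_ratPoint T pp (by rw [hp]; norm_num) hpl (t := 5)
      (by norm_num)
      (fun v hv => by rw [hpole (Or.inr (Or.inr (Or.inr (Or.inr (Or.inr (Or.inr (Or.inr (Or.inr (Or.inl hp))))))))) v hv, hp]; norm_num) x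
    have : 3 * l * 5 ∣ absRamificationIdx (pp : ℕ) (kOf (pilotDataOfK T.D T.K) pp.1 x) * 5 := by
      rw [show 3 * l * 5 = 15 * l by ring]; exact h15
    exact Nat.dvd_of_mul_dvd_mul_right (by norm_num) this
  · exact GenuineK.fifteen_mul_prime_dvd_absRamificationIdx_kOf_ratPoint_of_coprime T pp (by rw [hp]; norm_num) hpl (t := 1)
      (by norm_num) (by decide)
      (fun v hv => by rw [hpole (Or.inr (Or.inr (Or.inr (Or.inr (Or.inr (Or.inr (Or.inr (Or.inr (Or.inr hp))))))))) v hv, hp]; norm_num) x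

end Summit.ABC.IUTFork.Conditional

end
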